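import Mathlib
import Summits.CriticalPhenomena.Ising3DConformalLimit.Theses.HyperoctahedralRP
import Literature.MathematicalPhysics.QuantumFieldTheory.LatticeMirrorNormals
import Literature.MathematicalPhysics.QuantumFieldTheory.MirrorRPKernel

/-!
# Disproof work file — crux `HRP2Rigidity` (stmt-CriticalPhenomena-1979), standing disprover

Crux (route HyperoctahedralRP, item r2): a continuous positive kernel `K` on `ℝ³∖{0}`, homogeneous of
degree `-2Δ`, `1/2 ≤ Δ ≤ 1`, invariant AND reflection positive (finite point configurations in the open
half-space) w.r.t. the nine `B₃` mirror normals `e_i, e_i ± e_j`, is `O(3)`-invariant.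

STATUS after cycle 2 (2026-08-16): **no kill** — and a POSITIVE by-product: the GLOBAL step at `Δ = 1/2`
(a = 1) is solved on paper by a two-line leaf monotonicity (F9, Lean tools `leafPhi_antitone`,
`leaf_round_of_Phi_eq`); at `Δ = 1/2` even the six DIAGONAL mirrors alone suffice (F10). The open terrain
for a counterexample is `1/2 < Δ ≤ 1`, weakest at `Δ = 1` (F11, Δ-monotonicity). Everything below is either PROVED IN THIS FILE (Lean,
sorry-free) or recorded as paper/numerical findings in this docblock. The cycle-1 file (34 KB, gate evidence
`20260815T230459Z-Disproof.lean`, same findings F1–F6 plus two sorried near-misses `hrpPoly`,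
`b2Rigidity_d2`) is not mounted in gen-2 jails; this file re-proves its Lean content and extends it
(Schur descent `hrp2RigidityAt_of_add`, foot-point bound, LP search j007490+).

## Lean content (all sorry-free)

* `HRP2RigidityWithoutRP`, `hrp2Rigidity_false_without_RP` — LOAD-BEARING: the crux with the
  reflection-positivity conjunct dropped (nine mirror INVARIANCES kept) is FALSE; witness
  `quarticKernel x = (Σ xᵢ⁴)/(Σ xᵢ²)³` at `Δ = 1` (continuous, positive, homogeneous of degree `-2`,
  `O_h`-invariant, `K(e₀) = 1 ≠ 11/27 = K(θ_{(1,1,1)} e₀)`). Any proof must use RP.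
  `withoutRP_imp_crux` records that the variant is the crux minus one hypothesis.
* `even_of_mirrors` — TOOL: the three coordinate mirrors compose to `x ↦ -x`, so `K` is even; hence
  (`mirrorKernel_symm_of_even`) every Gram family `K(p_a - θ p_b)` is symmetric and the crux's RP conjunct is
  literally `IsMirrorRPKernel n K` (`rpForm_iff_isMirrorRPKernel`, `Iff.rfl`) with PSD Gram matrices
  (`posSemidef_of_rpForm`).
* `rp_two_point`, `footpoint_bound` — TOOL: the `m = 2` instance of RP is Cauchy–Schwarz; with homogeneity
  it gives `K z ≤ ⟪z,n⟫^(-2Δ) K n` for unit `n` (angular profile `C(ω) ≤ C(n)/cos^{2Δ}∠(ω,n)` for each of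
  the nine poles). This is ALL that `m ≤ 2` gives, and it does not force isotropy (paper: `C = 1 + ε φ`,
  `φ` smooth `O_h`-invariant with the 18 poles as non-degenerate local maxima, `ε` small, satisfies all
  nine foot-point bounds) — a proof must use configurations with `m ≥ 3` (i.e. the spectral side).
* `rpForm_mul` — TOOL (Schur, via `Matrix.PosSemidef.hadamard`): products of symmetric mirror-RP kernels
  are mirror-RP.
* `leaf_kernel_identity`, `leafPhi_antitone`, `leaf_round_of_Phi_eq` — TOOL (the a = 1 GLOBAL step, F9):
  for a positive discrete measure `ρ = Σ wᵢ δ_{σᵢ}` on `(0,∞)`, `Φ(s) = (1+s) Σ wᵢ (1-σᵢ)/(s+σᵢ)` is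
  non-increasing on `[0,∞)` with defect `(t-s) Σ wᵢ (1-σᵢ)²/((s+σᵢ)(t+σᵢ))`, and `Φ s = Φ t` for some `s < t`
  forces every charged atom to sit at `σ = 1`. (Measure version: identical computation under `∫`.)
* `HRP2RigidityAt Δ`, `hrp2Rigidity_iff_forall_at`, `hrp2RigidityAt_of_add`, `hrp2RigidityAt_half_of_one`
  — STRUCTURE (Δ-monotonicity): IF the round kernel `‖x‖^(-2Δ')` is nine-RP (Frank–Lieb 2010 Lemma 2.1 /
  Glimm–Jaffe Prop. 6.2.5: iff `2Δ' ≥ 1`; hypothesis `hround`, not in the tree in point-mass form) then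
  `HRP2RigidityAt (Δ + Δ') → HRP2RigidityAt Δ` (a counterexample `K` at `Δ` yields `K·‖x‖^(-2Δ')` at
  `Δ + Δ'`). So NON-rigidity is upward closed under `Δ ↦ Δ + [1/2, ∞)`: the crux at `Δ = 1` implies the crux
  at `Δ = 1/2`; `Δ = 1` (a = 1/2) is the WEAKEST point of the window and the right place to hunt; the
  mechanism critic's anisotropic nine-RP kernels `(Σ∂ᵢ⁴)²‖x‖^(-2D₀) + A‖x‖^(-2D₀-8)` (`Δ ≥ 9/2`) show the
  statement is genuinely false far above the window, so the window hypothesis `Δ ≤ 1` (more precisely: the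
  Stieltjes/Laplace dictionary `a = 3/2 - Δ ∈ (0,1]`) is load-bearing ON PAPER (not Lean-certified: needs RP
  of `‖x‖^(-2D₀)`).

## Findings on paper / numerics (F-list; details in the disprover's NOTES.md)

* F1 (dictionary, all refuters agree). `K̂(k) = |k|^(-2a) C(k̂)`, `a = 3/2 - Δ ∈ [1/2, 1]`; RP_n ⟺ every
  pencil `s ↦ K̂(√s n + q)`, `q ⊥ n`, is a Stieltjes function ⟺ on each meridian leaf of pole `n` through
  `u ⊥ n`, with `w = cos 2ψ`, the profile `G(w) = C(cos ψ u + sin ψ n)` is holomorphic on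
  `ℂ ∖ ((-∞,-1] ∪ [1,∞))` and `F(w) = (1+w)^a G(w)` is a Nevanlinna (Pick) function: spacelike spectral
  mass = jump of `Im G ≥ 0` across `w > 1` (equatorial wall `Re ψ = 0`), timelike mass = jump across
  `w < -1` with `arg G(t+i0) ∈ [-πa, π-πa]`.
* F2 (7-circle lemma, proved on paper by three refuters independently, re-derived here via Nevanlinna
  growth: `F` Nevanlinna ⇒ `|G(w)| ≤ A|w|^(2-a)/|Im w|` ⇒ an ENTIRE leaf profile is a polynomial of degree
  ≤ 1, and integrability of the timelike density kills degree 1): on a great circle through two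
  NON-perpendicular poles the two wall sets interleave, `G` is entire, hence constant. So `C ≡ c₀` on the
  3 coordinate circles `{k_i = 0}` and the 4 hexagon circles `{k₁ ± k₂ ± k₃ = 0}` (one connected net).
  More generally ANY leaf whose profile happens to be entire is constant: a counterexample must carry
  genuine spectral singularities on walls of generic leaves of every fan.
* F3 (books meet only on bipolar leaves). Off `S²`, `z = x+iy ∈ Q = {z·z = 1}` lies in the book of pole
  `n` iff `n ∈ span(x,y)`; two books meet exactly along one complexified bipolar circle (24 oblique pairs →
  the 7 rigid circles, 12 perpendicular pairs → shared walls, no information). Hence the nine leafwise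
  conditions interact ONLY through the values of `C` on `S²`: the crux is
  `⋂_{j=1..9} 𝒜_{n_j}(a) ∩ {O_h-invariant} = constants`, each `𝒜_n` a huge closed convex cone; by
  `O_h`-symmetry it is `𝒜_{e₃} ∩ 𝒜_{(e₁+e₂)/√2} ∩ {O_h-inv}`. Convexity ⇒ the crux is EQUIVALENT to
  tangent-CONE rigidity at the round kernel (one-sided deformations `1 + εh`, `ε > 0`, may add positive
  spacelike mass); the tangent SPACE (two-sided, bounded linear deformations) is trivial (cycle-1 F6) and
  decides nothing.
* F4 (dead counterexample families; do not retry): quadratic forms `(xᵀAx)^(-Δ)` (RP_n iff `n`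
  eigenvector; `diag(1,1,c)` passes exactly the five `D₄h` mirrors `e₁,e₂,e₃,e₁±e₂`), finite `B₃`-orbit
  sums and positive continuous mixtures of quadrics (branch points off the cut do not cancel), finite
  spherical-harmonic content (ONE mirror kills it: null-cone root splitting, item 4275), polynomial shadows
  `K̂ = F^(-a/m)` of every degree (cycle-1 paper proof: ellipse criterion + Rellich + genus count; kit
  j000947–950 to degree 12), rational/algebraic symbols (cycle 1), `1+εP₄`, `exp(εP₄)`, `(Σk⁴)^{±1/2}`
  (Hankel tests, all fail on DIAGONAL-pole meridians), ridge profiles `G(k̂·v)`, plane sections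
  `{ℓ·z = c}` as singular loci (dead for any three non-coplanar normals), `x`-side Gram tests of
  `diag(1,2,2)`-type kernels. The critic's `Δ ≥ 9/2` family and all `P(∂)²‖x‖^(-2D₀)` tricks need an even
  `B₃`-invariant `P` of degree ≥ 4 and leave the window.
  Added in cycle 2: (i) x-side ALGEBRAIC kernels `K = P(x)^(-Δ/deg)` are dead by the SAME root test as
  k-side symbols — RP_n forces `τ ↦ K(τ n + y)` holomorphic with `|K(τn+y)| ≤ K((Re τ) n)` on `Re τ > 0`, so
  `P(τ n + y)` may only have purely imaginary roots in `τ` for every real `y ⊥ n` and all nine `n`; e.g.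
  `((x·x)² + εΣxᵢ⁴)^(-Δ/2)` fails `e₃` for `ε > 0` (discriminant `-ε(|y|⁴+(1+ε)(y₁⁴+y₂⁴)) < 0`) and the
  diagonal mirror for `ε < 0` (discriminant `ε[-(6+2ε)a⁴ + 8a²b² + 8(1+ε)b⁴] < 0` at `a = 0`).
  (ii) Coordinate-separable profiles `C = Σᵢ Φ(k̂ᵢ²)`: the rigid circle `{k₃ = 0}` forces
  `Φ(x) + Φ(1-x) = const`, i.e. `Φ = (x+κ)^(-c) - (1+κ-x)^(-c)`-type antisymmetry, and the NEGATIVE timelike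
  term then violates `Re G ≥ 0` on `(-τ,-1)` (a = 1/2) — dead for every `c > 0`. (iii) Chow: if the
  holomorphic continuation of a counterexample `K` (conic on `ℂ³`) had a closed analytic singular set in
  `ℂ³∖0`, its projectivisation would be ALGEBRAIC in `ℂP²` and cycle 1's root-test theorem would kill it; a
  counterexample's continuation must be infinitely sheeted or have a natural boundary (this is exactly what
  card `projective-algebraization` proposes to exclude).
* F5 (explicit partial RP kernels, useful as test enemies). At `Δ = 1/2` every RP_{e₃} kernel is
  `K(x) = ∫_H Re(1/⟨ζ,x⟩) dα(ζ)`, `ζ = cos χ e₃ - i sin χ ξ̂`; a null-circle density `1 + ε cos 4φ` gives the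
  closed form `K_ε(x) = (2π/‖x‖)(1 + ε (x₁⁴ - 6x₁²x₂² + x₂⁴)/(‖x‖ + |x₃|)⁴)`, `|ε| < 1`: continuous,
  positive, degree `-1`, `D₄h`-invariant, RP for `e₃` (by construction) — and harmonic off the plane,
  which is why it cannot be nine-RP: at `Δ = 1/2` a kernel all of whose nine spectral measures are
  null-cone supported is harmonic on `ℝ³∖0`, homogeneous of degree `-1`, hence `c/‖x‖`. A counterexample at
  `Δ = 1/2` needs off-cone (timelike interior or spacelike) mass in EVERY fan; at `Δ = 1/2` it even needs
  SPACELIKE mass in the coordinate fans (F6).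
* F6 (a = 1, i.e. Δ = 1/2, half-proof). If fan `e₃` carries no spacelike mass then on every meridian of
  `e₃` the function `(1+s) f(s) = ∫ (1+s)/(s+σ) dρ(σ)`, `σ ≥ 1`, is increasing, so `C(e₃) ≥ C(u)` for all
  `u` on the equator `{k₃ = 0}` with equality iff the leaf is round; the equator is a rigid circle carrying
  the value `c₀ = C(e₃)`, so every meridian is round and `C ≡ c₀`. Hence at `Δ = 1/2` the crux is
  EQUIVALENT to "the coordinate fans carry no spacelike Källén–Lehmann mass"; spacelike mass of fan `e₃`
  can only sit over the four 90°-strips of the equator centred at `(±1,±1,0)/√2` (the lines over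
  `±e₁, ±e₂` lie on rigid leaves), and over `(1,1,0)/√2` it is the TIMELIKE mass of the perpendicular pole
  `(e₁+e₂)/√2` on the shared leaf `{k₁ = k₂}` — consistent signs, no contradiction from the pair alone.
* F7 (what a counterexample must look like, all Δ). Real-analytic `O_h`-invariant `C` on `S²` (LOCAL step:
  at every point ≥ 4 of the nine fans see it as an interior point with ≥ 2 transverse leaf directions and
  uniform strip half-width, so a Bernstein/Siciak cross argument applies), `C = c₀` on the 7-circle net,
  non-constant inside the 32 faces, whose leafwise continuations in the two pole classes have wall
  singularities = positive jump measures supported away from the 4 (coordinate class) resp. 6 (diagonal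
  class: lines over `±d'` and `(±d' ± √2 e₃)/√3`) forbidden vertical wall lines. No construction principle
  for such an object is known; every closure operation available inside the window (positive combinations,
  `O_h`-averaging, pointwise limits) preserves roundness, and the degree-raising ones (Schur products,
  `P(∂)²`) leave the window — this is WHY the statement resists cheap refutation and why it is plausible.
* F8 (search running, cycle 2). LP feasibility search on the x-side representation (two angular measures
  `α_{e₃}`, `α_d`, constraints = `O_h`-invariance + equality of the two representations on the common
  half-spaces, objective = anisotropy `K(e₃) - K((1,1,1)/√3)` etc., discretisation floor `τ*` measured):
  kit j007490 (Δ = 1 smoke) and follow-ups; a counterexample would appear as anisotropy `O(1)` stable under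
  refinement with small generalisation error. Results are appended to the item as compute evidence.
* F9 (**GLOBAL step at a = 1, i.e. Δ = 1/2, solved on paper; conditional only on the LOCAL/dictionary step**:
  `C := |k|² K̂` is a continuous function on `S²` and every pencil of each of the nine normals is Stieltjes).
  On a leaf of pole `n` through `u ⊥ n` (`s = tan²ψ`): `f(s) = C/(1+s) = ∫dρ(σ)/(s+σ)` with `ρ` FINITE,
  `ρ(ℝ₊) = C(n)`, `∫dρ/σ = C(u)`, and the identity `(1+s)/(s+σ) = 1 + (1-σ)/(s+σ)` gives
  `C(s) - C(n) = ∫ (1-σ)/(s+σ) dρ(σ)`, whence (`leaf_kernel_identity`)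
  `Φ(s) := (1+s)(C(s) - C(n))` satisfies `Φ(s) - Φ(t) = (t-s)∫(1-σ)²/((s+σ)(t+σ))dρ ≥ 0` (`s < t`): Φ is
  NON-INCREASING from `Φ(0) = C(u) - C(n)`, strictly unless `ρ = C(n)δ₁` (round leaf). Consequences:
  (1) poles are global maxima of `C` (at a max point `k*` of `C - C(P)` pick a pole `P` of the class whose
  equator misses `k*`; `(1+s*)m ≤ Φ_P(0) ≤ m` ⇒ `m = 0`), so `C ≤ c₀ := C(e_i) = C(diagonal poles)`;
  (2) interleaving on a circle through two poles at angle `γ ∉ {0, π/2}` carrying the value `c₀` forces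
  `Φ ≡ 0` on an interval ⇒ the circle is round: the 7 rigid circles, with NO growth/Liouville input;
  (3) sweep with `P = (e₁+e₃)/√2`: every `P`-leaf meets the rigid circle `{k₃ = 0}` at an interior point
  where `Φ_P = 0 = max` ⇒ `Φ_P ≡ 0` on an interval ⇒ the leaf is round; all but one leaf ⇒ `C ≡ c₀`. ∎
  So at `Δ = 1/2` the crux REDUCES to the LOCAL step. Residual loophole for a counterexample at `Δ = 1/2`:
  a nine-RP `K` (continuous!) whose `C` is NOT continuous — not obviously excluded (the degree `-1 → -2`
  Funk–Hecke multipliers grow like `ℓ^{1/2}`, so continuity of `K` does not give continuity of `C` for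
  free); the disprover rates it unlikely.
* F10 (hypothesis mutation at Δ = 1/2). The same argument run with the six DIAGONAL fans only (all twelve
  diagonal poles share one value by `O_h`; hexagon circles `{k₁±k₂±k₃ = 0}` carry poles every 60° ⇒ rigid
  by interleaving; sweep with `P = (e₁+e₃)/√2` across `{k₁+k₂+k₃ = 0} ∌ P`) proves: at `Δ = 1/2`,
  `O_h`-invariance + RP for the six diagonal mirrors ⇒ isotropy. The three coordinate-mirror RPs are
  REDUNDANT at `Δ = 1/2` (provers: do not look for them in the proof); coordinate-only + `O_h` is NOT rigid
  at any Δ (`Σ_π (xᵀA_πx)^(-Δ)`). Whether diagonal-only suffices for `1/2 < Δ ≤ 1` is open.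
* F11 (why `a < 1`, i.e. `1/2 < Δ ≤ 1`, is different, and where to hunt). For `a < 1` the round leaf
  measure is spread (`(σ-1)^(-a)dσ`, infinite mass), `ρ - C(n)ρ⁰` has no sign on `σ > 1`, and admissible
  leaves DO have interior bumps. In the `w = cos 2ψ` picture the leaf class is
  `𝒢_a = {G real-analytic near [-1,1], holomorphic off (-∞,-1-δ] ∪ [1+δ,∞), (1+w)^a G Nevanlinna}`;
  elementary members (τ > 1): `(τ+w)^(-c)` for `0 ≤ c ≤ a` (decreasing: pole > equator, timelike ray),
  `(τ-w)^(-c)` and `(τ+w)^(+c)` for `0 ≤ c ≤ 1-a` (increasing); `𝒢_a` is a convex cone, and e.g. at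
  `a = 1/2`, `G = (2+w)^(-1/2) + λ(1.1+w)^(1/2)` has an interior maximum on `(-1,1)` for suitable `λ`
  (derivative `> 0` at `-1`, `< 0` at `+1`). (A bare timelike atom `A/(s+σ₁)`, `σ₁ > 2`, also bumps but
  violates real-analyticity of `C` at the pole: at `a < 1` pole-analyticity forces
  `(1+s)^a ∫dρ/(s+σ)` to be analytic in `1/s`, i.e. `G` analytic at `w = -1` — use the `𝒢_a` description.)
  At `a = 1` none of this happens (`c ≤ 1 - a = 0`). So no leafwise maximum principle survives for
  `a < 1`; together with the Δ-monotonicity (`hrp2RigidityAt_of_add`: a counterexample at `Δ` propagates to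
  `Δ + 1/2`) this singles out `Δ = 1` (`a = 1/2`) as the place where the crux is weakest; equator values
  may exceed `c₀` there. The LP search (F8) runs at `Δ = 1` first.
* F12 (**timelike tangent space — a LINEAR problem whose non-triviality would kill the crux on ALL of
  `(1/2, 1]` at once**). For `0 < a < 1` the round timelike phase `arg G = 0` lies in the INTERIOR of the
  admissible band `[-πa, π-πa]` (at `a = 1` it is an endpoint — hence F9), while the spacelike band `[0,π]`
  for `Im`-jumps is one-sided. Consequence (checked via boundary values + Phragmén–Lindelöf on each pencil):
  let `V_R` := { `H` real-analytic, `O_h`-invariant on `S²` : for every pole `n` of the nine and every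
  `u ⊥ n`, `t ↦ H(√(1-t) u + √t n)` (`t = k_n²`) is BOUNDED holomorphic on `ℂ ∖ [t_R, ∞)` }, `t_R > 1`
  (equivalently: along every leaf `ψ ↦ H` is bounded holomorphic off the slits
  `{Re ψ ∈ π/2 + πℤ, |Im ψ| ≥ η_R}` over the POLES; equatorial walls fully crossable). `V_R` does not depend on
  `Δ`. If `V_R` contains a non-constant `H` then `K₀ + εK_H` (`K₀ = ‖x‖^(-2Δ)`, `K̂_H = |k|^(-2a)H`) is an
  anisotropic nine-RP kernel for all small `|ε|` and EVERY `Δ ∈ (1/2, 1]` — the crux would be false on the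
  whole half-open window while true at `Δ = 1/2`. Facts: (i) `V_R` is an algebra; every `H ∈ V_R` is constant
  on all 13 bipolar circles (9 mirror + 4 hexagon: the two fans' slit sets are disjoint even for
  PERPENDICULAR pairs, since equatorial walls are not slits here). (ii) Single-fan classes are huge
  (`Φ(kᵀBk)` with `n` an extremal eigendirection of `B`: smallest eigenvalue ↔ `sing Φ ⊂ (-∞,-κ]`, largest
  ↔ `sing Φ ⊂ [κ',∞)`); `Φ(k₂²)` lies in `V^{(e₁)} ∩ V^{(e₃)}` but not `V^{(e₂)}`; a single quadric
  composition lies in `V^{(e₁)}∩V^{(e₂)}∩V^{(e₃)}` only if each `e_i` is an extremal eigendirection with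
  compatible `Φ` — impossible; compositions `Ψ(polynomial invariants)` are dead (polynomial maps are
  surjective from the slit domain). (iii) Geometric form: the singular locus of `H` in `Q` may meet the book
  of `n` only in its polar wall `{Re z ∥ n, Im z ⊥ n}` above height `η_R`; for fan `e₃`'s edge curve
  `η = h(ω)` the complexification `z(ω)`, `ω` complex, has `Re z ∥ e₁` only if `cos(Im h) = 0` and
  `sin(Re ω) = 0`, so it must AVOID the `e₁`- and `e₂`-books on the whole domain of `h`
  (`det[Re z, Im z, e₁] ≠ 0`). (iv) Cycle 1 (F6 there) asserts the larger two-sided tangent space is trivial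
  (cross theorem + Liouville); no proof is on file in gen 2. Verdict: `V_R = ℝ` is plausible but UNPROVED; a
  prover who proves it has NOT proved the crux (one-sided spacelike deformations remain), a disprover who
  finds `H ∈ V_R ∖ ℝ` has refuted it for all `Δ ∈ (1/2,1]`. Numerical null-space probe: kit job lin9rp
  (see NOTES).
* F13 (structure of the admissible profile class; cheap but useful). Let `𝒜(a)` = angular profiles `C > 0` on
  `S²` all of whose nine-fan leaf functions `F = (1+w)^a C` are Nevanlinna. Then `log 𝒜(a)` is CONVEX
  (`F₁^θ F₂^(1-θ)` is Nevanlinna), `𝒜(a)` is closed under positive sums, pointwise limits, `O_h`-averaging,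
  geometric means and POWERS `C ↦ C^θ` for `0 ≤ θ ≤ 1` (not `θ > 1`), and across exponents
  `𝒜(a₁)^θ · 𝒜(a₂)^(1-θ) ⊂ 𝒜(θa₁ + (1-θ)a₂)`. The recession cone of `log 𝒜(a)` is the constants (large
  powers break the phase band), so every non-constant direction `h` has a finite `θ_max(h)`; the crux is
  "`log 𝒜(a)` = constants". None of these closure operations creates anisotropy from round data — a
  counterexample needs a genuinely new seed (F7), which is why cheap constructions keep failing.
  (x-side: the nine-RP kernels at fixed `Δ` form a convex cone closed under Schur products only ACROSS
  exponents; no `x`-side meaning of `C^θ`.)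
-/

noncomputable section

open scoped BigOperators InnerProductSpace Matrix

namespace Summit.CriticalPhenomena.Ising3DConformalLimit.Cruxes.HRP2Rigidity.Disproof

abbrev E3 := EuclideanSpace ℝ (Fin 3)

/-- quartic anisotropic kernel (Σ x_i^4)/(Σ x_i^2)^3, degree -2 -/
noncomputable def quarticKernel (x : E3) : ℝ := (∑ i, x i ^ 4) / (∑ i, x i ^ 2) ^ 3

theorem sum_sq_pos {x : E3} (hx : x ≠ 0) : 0 < ∑ i, x i ^ 2 := by
  have : ∃ i, x i ≠ 0 := by
    by_contra h
    push Not at h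
    exact hx (PiLp.ext fun i => by simpa using h i)
  obtain ⟨i, hi⟩ := this
  exact Finset.sum_pos' (fun j _ => by positivity) ⟨i, Finset.mem_univ _, by positivity⟩

theorem sum_fourth_pos {x : E3} (hx : x ≠ 0) : 0 < ∑ i, x i ^ 4 := by
  have : ∃ i, x i ≠ 0 := by
    by_contra h
    push Not at h
    exact hx (PiLp.ext fun i => by simpa using h i)
  obtain ⟨i, hi⟩ := this
  exact Finset.sum_pos' (fun j _ => by positivity) ⟨i, Finset.mem_univ _, by positivity⟩

theorem quarticKernel_pos {x : E3} (hx : x ≠ 0) : 0 < quarticKernel x :=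
  div_pos (sum_fourth_pos hx) (pow_pos (sum_sq_pos hx) 3)

theorem continuous_coord (i : Fin 3) : Continuous fun x : E3 => x i :=
  (EuclideanSpace.proj i).continuous

theorem quarticKernel_continuousOn : ContinuousOn quarticKernel {0}ᶜ := by
  have h4 : Continuous fun x : E3 => ∑ i, x i ^ 4 :=
    continuous_finsetSum _ fun i _ => (continuous_coord i).pow 4
  have h2 : Continuous fun x : E3 => (∑ i, x i ^ 2) ^ 3 :=
    (continuous_finsetSum _ fun i _ => (continuous_coord i).pow 2).pow 3
  refine ContinuousOn.div h4.continuousOn h2.continuousOn ?_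
  intro x hx
  exact (pow_pos (sum_sq_pos hx) 3).ne'

theorem quarticKernel_smul {c : ℝ} (hc : 0 < c) (x : E3) :
    quarticKernel (c • x) = c ^ (-(2 * (1:ℝ))) * quarticKernel x := by
  unfold quarticKernel
  simp only [PiLp.smul_apply, smul_eq_mul, mul_pow]
  rw [← Finset.mul_sum, ← Finset.mul_sum]
  rw [show (-(2 * (1:ℝ))) = ((-2 : ℤ) : ℝ) by norm_num, Real.rpow_intCast]
  by_cases hs : ∑ i, x i ^ 2 = 0
  · simp [hs]
  · field_simp


open Literature.MathematicalPhysics.QuantumFieldTheory in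
/-- coordinate-even, permutation-symmetric sums are invariant under the nine lattice mirrors -/
theorem sum_comp_reflection_eq (F : ℝ → ℝ) (hF : ∀ a, F (-a) = F a) (n : E3)
    (hn : ∃ i j : Fin 3, i ≠ j ∧ (n = EuclideanSpace.single i 1 ∨
      n = EuclideanSpace.single i 1 + EuclideanSpace.single j 1 ∨
      n = EuclideanSpace.single i 1 - EuclideanSpace.single j 1)) (x : E3) :
    ∑ l, F (((ℝ ∙ n)ᗮ.reflection x) l) = ∑ l, F (x l) := by
  obtain ⟨i, j, hij, rfl | rfl | rfl⟩ := hn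
  · refine Finset.sum_congr rfl fun l _ => ?_
    rw [reflection_single_apply]
    split_ifs <;> simp [hF]
  · calc ∑ l, F (((ℝ ∙ (EuclideanSpace.single i (1:ℝ) + EuclideanSpace.single j 1))ᗮ.reflection x) l)
        = ∑ l, F (x (Equiv.swap i j l)) := by
          refine Finset.sum_congr rfl fun l _ => ?_
          rw [reflection_single_add_single_apply hij]
          by_cases hli : l = i
          · subst hli; simp [hF]
          · by_cases hlj : l = j
            · subst hlj; simp [hli, hF]
            · simp [hli, hlj, Equiv.swap_apply_of_ne_of_ne hli hlj]
      _ = ∑ l, F (x l) := Equiv.sum_comp (Equiv.swap i j) (fun l => F (x l))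
  · calc ∑ l, F (((ℝ ∙ (EuclideanSpace.single i (1:ℝ) - EuclideanSpace.single j 1))ᗮ.reflection x) l)
        = ∑ l, F (x (Equiv.swap i j l)) := by
          refine Finset.sum_congr rfl fun l _ => ?_
          rw [reflection_single_sub_single_apply hij]
      _ = ∑ l, F (x l) := Equiv.sum_comp (Equiv.swap i j) (fun l => F (x l))

theorem quarticKernel_reflection (n : E3)
    (hn : ∃ i j : Fin 3, i ≠ j ∧ (n = EuclideanSpace.single i 1 ∨
      n = EuclideanSpace.single i 1 + EuclideanSpace.single j 1 ∨
      n = EuclideanSpace.single i 1 - EuclideanSpace.single j 1)) (x : E3) :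
    quarticKernel (((ℝ ∙ n)ᗮ).reflection x) = quarticKernel x := by
  unfold quarticKernel
  rw [sum_comp_reflection_eq (fun a => a ^ 4) (fun a => by ring) n hn x,
    sum_comp_reflection_eq (fun a => a ^ 2) (fun a => by ring) n hn x]

/-- the body diagonal `(1,1,1)` -/
noncomputable def v111 : E3 :=
  EuclideanSpace.single 0 1 + EuclideanSpace.single 1 1 + EuclideanSpace.single 2 1

theorem v111_apply (l : Fin 3) : v111 l = 1 := by
  unfold v111
  fin_cases l <;> simp

open Literature.MathematicalPhysics.QuantumFieldTheory in
theorem reflection_v111_e0_apply (l : Fin 3) :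
    ((ℝ ∙ v111)ᗮ.reflection (EuclideanSpace.single (0 : Fin 3) (1 : ℝ))) l =
      (if l = 0 then 1 else 0) - 2 / 3 := by
  have hinner : ⟪EuclideanSpace.single (0 : Fin 3) (1 : ℝ), v111⟫_ℝ = 1 := by
    rw [inner_single_one_left, v111_apply]
  have hnorm : ‖v111‖ ^ 2 = 3 := by
    rw [EuclideanSpace.norm_eq, Real.sq_sqrt (Finset.sum_nonneg fun _ _ => by positivity)]
    norm_num [v111_apply, Fin.sum_univ_three]
  rw [mirrorReflection_apply, hinner, hnorm]
  norm_num [v111_apply]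

theorem quarticKernel_e0 : quarticKernel (EuclideanSpace.single (0 : Fin 3) (1 : ℝ)) = 1 := by
  unfold quarticKernel
  simp

theorem quarticKernel_reflection_v111_e0 :
    quarticKernel ((ℝ ∙ v111)ᗮ.reflection (EuclideanSpace.single (0 : Fin 3) (1 : ℝ))) = 11 / 27 := by
  unfold quarticKernel
  have h1 : ((ℝ ∙ v111)ᗮ.reflection (EuclideanSpace.single (0 : Fin 3) (1 : ℝ))) 0 = 1 / 3 := by
    rw [reflection_v111_e0_apply, if_pos rfl]; norm_num
  have h2 : ((ℝ ∙ v111)ᗮ.reflection (EuclideanSpace.single (0 : Fin 3) (1 : ℝ))) 1 = -(2 / 3) := by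
    rw [reflection_v111_e0_apply, if_neg (by decide)]; norm_num
  have h3 : ((ℝ ∙ v111)ᗮ.reflection (EuclideanSpace.single (0 : Fin 3) (1 : ℝ))) 2 = -(2 / 3) := by
    rw [reflection_v111_e0_apply, if_neg (by decide)]; norm_num
  simp only [Fin.sum_univ_three, h1, h2, h3]
  norm_num


/-- The nine-normal shape predicate, verbatim from the crux. -/
def NineNormal (n : E3) : Prop :=
  ∃ i j : Fin 3, i ≠ j ∧ (n = EuclideanSpace.single i 1 ∨
    n = EuclideanSpace.single i 1 + EuclideanSpace.single j 1 ∨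
    n = EuclideanSpace.single i 1 - EuclideanSpace.single j 1)

theorem nineNormal_single (i : Fin 3) : NineNormal (EuclideanSpace.single i 1) := by
  obtain ⟨j, hj⟩ := exists_ne i
  exact ⟨i, j, hj.symm, Or.inl rfl⟩

open Literature.MathematicalPhysics.QuantumFieldTheory in
/-- composing the three coordinate mirrors gives `x ↦ -x` -/
theorem reflection_e0_e1_e2 (x : E3) :
    (ℝ ∙ EuclideanSpace.single (0 : Fin 3) (1 : ℝ))ᗮ.reflection
      ((ℝ ∙ EuclideanSpace.single (1 : Fin 3) (1 : ℝ))ᗮ.reflection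
        ((ℝ ∙ EuclideanSpace.single (2 : Fin 3) (1 : ℝ))ᗮ.reflection x)) = -x := by
  ext l
  simp only [reflection_single_apply, PiLp.neg_apply]
  fin_cases l <;> simp

/-- TOOL: invariance under the three coordinate mirrors makes `K` even. -/
theorem even_of_mirrors {K : E3 → ℝ}
    (hinv : ∀ n : E3, NineNormal n → ∀ x, K (((ℝ ∙ n)ᗮ).reflection x) = K x) (x : E3) :
    K (-x) = K x := by
  rw [← reflection_e0_e1_e2 x, hinv _ (nineNormal_single 0), hinv _ (nineNormal_single 1),
    hinv _ (nineNormal_single 2)]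

/-- 2×2 principal-minor inequality from a real quadratic form that is nonnegative on `Fin 2`. -/
theorem sq_le_mul_of_quadForm_nonneg {a b d : ℝ}
    (h : ∀ c : Fin 2 → ℝ, 0 ≤ ∑ i, ∑ j, c i * c j * (![![a, b], ![b, d]] i j)) :
    b ^ 2 ≤ a * d := by
  have ha : 0 ≤ a := by simpa [Fin.sum_univ_two] using h ![1, 0]
  have hd : 0 ≤ d := by simpa [Fin.sum_univ_two] using h ![0, 1]
  have h1 : 0 ≤ d * (a * d - b ^ 2) := by
    have := h ![d, -b]; simp [Fin.sum_univ_two] at this; nlinarith [this]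
  have h2 : 0 ≤ a * (a * d - b ^ 2) := by
    have := h ![-b, a]; simp [Fin.sum_univ_two] at this; nlinarith [this]
  have h3 : 0 ≤ a + d + 2 * b := by
    have := h ![1, 1]; simp [Fin.sum_univ_two] at this; nlinarith [this]
  have h4 : 0 ≤ a + d - 2 * b := by
    have := h ![1, -1]; simp [Fin.sum_univ_two] at this; nlinarith [this]
  by_cases hpos : 0 < a + d
  · nlinarith [h1, h2, hpos]
  · have had : a + d = 0 := le_antisymm (not_lt.1 hpos) (add_nonneg ha hd)
    have hb : b = 0 := by nlinarith [h3, h4, had]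
    subst hb; nlinarith [ha, hd]

open Literature.MathematicalPhysics.QuantumFieldTheory in
/-- TOOL (two-point RP): the `m = 2` instance of reflection positivity, for a kernel symmetric on the
half-space, is the Cauchy–Schwarz inequality `K(p - θq)² ≤ K(p - θp) K(q - θq)`. -/
theorem rp_two_point {n : E3} {K : E3 → ℝ}
    (hRP : ∀ (m : ℕ) (p : Fin m → E3) (c : Fin m → ℝ), (∀ a, 0 < inner ℝ (p a) n) →
      0 ≤ ∑ a, ∑ b, c a * c b * K (p a - ((ℝ ∙ n)ᗮ).reflection (p b)))
    (hsymm : ∀ p q : E3, K (p - (ℝ ∙ n)ᗮ.reflection q) = K (q - (ℝ ∙ n)ᗮ.reflection p))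
    {p q : E3} (hp : 0 < ⟪p, n⟫_ℝ) (hq : 0 < ⟪q, n⟫_ℝ) :
    K (p - (ℝ ∙ n)ᗮ.reflection q) ^ 2 ≤
      K (p - (ℝ ∙ n)ᗮ.reflection p) * K (q - (ℝ ∙ n)ᗮ.reflection q) := by
  apply sq_le_mul_of_quadForm_nonneg
  intro c
  have h := hRP 2 ![p, q] c (fun a => by fin_cases a <;> simpa)
  convert h using 1
  simp only [Fin.sum_univ_two, Matrix.cons_val_zero, Matrix.cons_val_one]
  rw [hsymm q p]

open Literature.MathematicalPhysics.QuantumFieldTheory in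
/-- TOOL (foot-point bound): under the crux hypotheses (evenness via the coordinate mirrors,
`θ_n`-invariance, RP for `n`, homogeneity) every value of `K` in the open half-space of a UNIT normal
`n` is bounded by the value at the foot point on the normal axis:
`K z ≤ ⟪z, n⟫ ^ (-2Δ) * K n`, i.e. `C(ω) ≤ C(n) / cos^{2Δ} ∠(ω, n)` for the angular profile. -/
theorem footpoint_bound {n : E3} {K : E3 → ℝ} {Δ : ℝ} (hn : ‖n‖ = 1)
    (heven : ∀ x, K (-x) = K x) (hinv : ∀ x, K ((ℝ ∙ n)ᗮ.reflection x) = K x)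
    (hRP : ∀ (m : ℕ) (p : Fin m → E3) (c : Fin m → ℝ), (∀ a, 0 < inner ℝ (p a) n) →
      0 ≤ ∑ a, ∑ b, c a * c b * K (p a - ((ℝ ∙ n)ᗮ).reflection (p b)))
    (hhom : ∀ c : ℝ, 0 < c → ∀ x, K (c • x) = c ^ (-(2 * Δ)) * K x)
    (hKn : 0 ≤ K n) {z : E3} (hz : 0 < ⟪z, n⟫_ℝ) :
    K z ≤ ⟪z, n⟫_ℝ ^ (-(2 * Δ)) * K n := by
  have hsymm := mirrorKernel_symm_of_even heven hinv
  set t := ⟪z, n⟫_ℝ with ht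
  have hθz : ∀ x : E3, (ℝ ∙ n)ᗮ.reflection x = x - (2 * ⟪x, n⟫_ℝ) • n := by
    intro x; rw [mirrorReflection_apply, hn]; norm_num
  set p : E3 := (1 / 2 : ℝ) • z with hp_def
  set q : E3 := t • n - (1 / 2 : ℝ) • z with hq_def
  have hnn : ⟪n, n⟫_ℝ = 1 := by rw [real_inner_self_eq_norm_sq, hn]; norm_num
  have hpn : ⟪p, n⟫_ℝ = t / 2 := by
    rw [hp_def, real_inner_smul_left]; ring
  have hqn : ⟪q, n⟫_ℝ = t / 2 := by
    rw [hq_def, inner_sub_left, real_inner_smul_left, real_inner_smul_left, hnn, ← ht]; ring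
  have hp : 0 < ⟪p, n⟫_ℝ := by rw [hpn]; linarith
  have hq : 0 < ⟪q, n⟫_ℝ := by rw [hqn]; linarith
  have hpq : p - (ℝ ∙ n)ᗮ.reflection q = z := by
    rw [hθz q, hqn, hq_def, hp_def]; module
  have hpp : p - (ℝ ∙ n)ᗮ.reflection p = t • n := by
    rw [hθz p, hpn, hp_def]; module
  have hqq : q - (ℝ ∙ n)ᗮ.reflection q = t • n := by
    rw [hθz q, hqn]; module
  have key := rp_two_point hRP hsymm hp hq
  rw [hpq, hpp, hqq] at key
  have htn : K (t • n) = t ^ (-(2 * Δ)) * K n := hhom t hz n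
  rw [htn] at key
  have hrhs : 0 ≤ t ^ (-(2 * Δ)) * K n := mul_nonneg (Real.rpow_nonneg hz.le _) hKn
  nlinarith [key, hrhs, sq_nonneg (K z - t ^ (-(2 * Δ)) * K n)]


/-- The reflection-positivity conjunct of the crux, verbatim (it is
`Literature.MathematicalPhysics.QuantumFieldTheory.IsMirrorRPKernel n K` by `Iff.rfl`). -/
def RPForm (n : E3) (K : E3 → ℝ) : Prop :=
  ∀ (m : ℕ) (p : Fin m → E3) (c : Fin m → ℝ), (∀ a, 0 < inner ℝ (p a) n) →
    0 ≤ ∑ a, ∑ b, c a * c b * K (p a - ((ℝ ∙ n)ᗮ).reflection (p b))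

theorem rpForm_iff_isMirrorRPKernel (n : E3) (K : E3 → ℝ) :
    RPForm n K ↔ Literature.MathematicalPhysics.QuantumFieldTheory.IsMirrorRPKernel n K := Iff.rfl

theorem quadForm_eq_dotProduct {m : ℕ} (M : Matrix (Fin m) (Fin m) ℝ) (c : Fin m → ℝ) :
    ∑ a, ∑ b, c a * c b * M a b = c ⬝ᵥ (M *ᵥ c) := by
  simp only [dotProduct, Matrix.mulVec, Finset.mul_sum]
  exact Finset.sum_congr rfl fun a _ => Finset.sum_congr rfl fun b _ => by ring

/-- A symmetric RP Gram family is a positive semidefinite matrix. -/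
theorem posSemidef_of_rpForm {n : E3} {K : E3 → ℝ} (hK : RPForm n K)
    (hsymm : ∀ p q : E3, K (p - (ℝ ∙ n)ᗮ.reflection q) = K (q - (ℝ ∙ n)ᗮ.reflection p))
    {m : ℕ} (p : Fin m → E3) (hp : ∀ a, 0 < ⟪p a, n⟫_ℝ) :
    (Matrix.of fun a b => K (p a - (ℝ ∙ n)ᗮ.reflection (p b))).PosSemidef := by
  refine Matrix.PosSemidef.of_dotProduct_mulVec_nonneg ?_ ?_
  · refine Matrix.IsHermitian.ext fun a b => ?_
    simp only [Matrix.of_apply, star_trivial]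
    exact hsymm _ _
  · intro x
    rw [star_trivial, ← quadForm_eq_dotProduct]
    simpa only [Matrix.of_apply] using hK m p x hp

/-- TOOL (Schur): the pointwise product of two symmetric mirror-RP kernels is mirror-RP
(Schur product theorem, `Matrix.PosSemidef.hadamard`). -/
theorem rpForm_mul {n : E3} {K₁ K₂ : E3 → ℝ} (h₁ : RPForm n K₁) (h₂ : RPForm n K₂)
    (hs₁ : ∀ p q : E3, K₁ (p - (ℝ ∙ n)ᗮ.reflection q) = K₁ (q - (ℝ ∙ n)ᗮ.reflection p))
    (hs₂ : ∀ p q : E3, K₂ (p - (ℝ ∙ n)ᗮ.reflection q) = K₂ (q - (ℝ ∙ n)ᗮ.reflection p)) :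
    RPForm n (fun x => K₁ x * K₂ x) := by
  intro m p c hp
  have hM := (posSemidef_of_rpForm h₁ hs₁ p hp).hadamard (posSemidef_of_rpForm h₂ hs₂ p hp)
  have := hM.dotProduct_mulVec_nonneg c
  rw [star_trivial, ← quadForm_eq_dotProduct] at this
  simpa only [Matrix.hadamard_apply, Matrix.of_apply] using this

/-- The crux body at a FIXED exponent `Δ` (the window hypotheses removed). -/
def HRP2RigidityAt (Δ : ℝ) : Prop :=
  ∀ (K : E3 → ℝ), ContinuousOn K {0}ᶜ → (∀ x, x ≠ 0 → 0 < K x) →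
    (∀ c : ℝ, 0 < c → ∀ x, K (c • x) = c ^ (-(2 * Δ)) * K x) →
    (∀ n : E3, NineNormal n →
      (∀ x, K (((ℝ ∙ n)ᗮ).reflection x) = K x) ∧ RPForm n K) →
    ∀ (R : E3 ≃ₗᵢ[ℝ] E3) (x : E3), K (R x) = K x

theorem hrp2Rigidity_iff_forall_at :
    Summit.CriticalPhenomena.Ising3DConformalLimit.Theses.HyperoctahedralRP.HRP2Rigidity ↔
      ∀ Δ : ℝ, 1/2 ≤ Δ → Δ ≤ 1 → HRP2RigidityAt Δ := by
  constructor
  · intro h Δ h1 h2 K hc hpos hhom hnine R x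
    exact h Δ K h1 h2 hc hpos hhom hnine R x
  · intro h Δ K h1 h2 hc hpos hhom hnine R x
    exact h Δ h1 h2 K hc hpos hhom hnine R x

/-- the round kernel `‖x‖^(-2Δ')` -/
noncomputable def roundKernel (Δ' : ℝ) (x : E3) : ℝ := ‖x‖ ^ (-(2 * Δ'))

theorem roundKernel_reflection (Δ' : ℝ) (n x : E3) :
    roundKernel Δ' ((ℝ ∙ n)ᗮ.reflection x) = roundKernel Δ' x := by
  simp [roundKernel]

theorem roundKernel_neg (Δ' : ℝ) (x : E3) : roundKernel Δ' (-x) = roundKernel Δ' x := by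
  simp [roundKernel, norm_neg]

/-- STRUCTURE (Δ-monotonicity / Schur descent): if the round kernel `‖x‖^(-2Δ')` is mirror-RP
for the nine lattice normals (Frank–Lieb 2010, Lemma 2.1 / Glimm–Jaffe Prop. 6.2.5: true iff
`2Δ' ≥ 1` in `ℝ³`; a HYPOTHESIS here, not in the tree in point-mass form), then rigidity at
exponent `Δ + Δ'` implies rigidity at exponent `Δ`: a counterexample `K` at `Δ` gives the
counterexample `K · ‖x‖^(-2Δ')` at `Δ + Δ'` (Schur product). Contrapositive: NON-rigidity is
upward closed under `Δ ↦ Δ + Δ'`, `2Δ' ≥ 1`; within the window, the crux at `Δ = 1` implies the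
crux at `Δ = 1/2`, and `Δ = 1` is the weakest point of the window. -/
theorem hrp2RigidityAt_of_add {Δ Δ' : ℝ}
    (hround : ∀ n : E3, NineNormal n → RPForm n (roundKernel Δ'))
    (h : HRP2RigidityAt (Δ + Δ')) : HRP2RigidityAt Δ := by
  intro K hc hpos hhom hnine R x
  set K' : E3 → ℝ := fun y => K y * roundKernel Δ' y with hK'
  have hinv : ∀ n : E3, NineNormal n → ∀ y, K (((ℝ ∙ n)ᗮ).reflection y) = K y :=
    fun n hn => (hnine n hn).1
  have heven : ∀ y, K (-y) = K y := even_of_mirrors hinv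
  have hc' : ContinuousOn K' {0}ᶜ := by
    refine hc.mul ?_
    intro y hy
    have hy' : ‖y‖ ≠ 0 := norm_ne_zero_iff.2 hy
    exact (continuous_norm.continuousAt.rpow_const (Or.inl hy')).continuousWithinAt
  have hpos' : ∀ y, y ≠ 0 → 0 < K' y := fun y hy =>
    mul_pos (hpos y hy) (Real.rpow_pos_of_pos (norm_pos_iff.2 hy) _)
  have hhom' : ∀ c : ℝ, 0 < c → ∀ y, K' (c • y) = c ^ (-(2 * (Δ + Δ'))) * K' y := by
    intro c hcpos y
    simp only [hK', roundKernel]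
    rw [hhom c hcpos y, norm_smul, Real.norm_of_nonneg hcpos.le,
      Real.mul_rpow hcpos.le (norm_nonneg _),
      show -(2 * (Δ + Δ')) = -(2 * Δ) + -(2 * Δ') by ring, Real.rpow_add hcpos]
    ring
  have hnine' : ∀ n : E3, NineNormal n →
      (∀ y, K' (((ℝ ∙ n)ᗮ).reflection y) = K' y) ∧ RPForm n K' := by
    intro n hn
    refine ⟨fun y => by simp only [hK', hinv n hn y, roundKernel_reflection], ?_⟩
    exact rpForm_mul (hnine n hn).2 (hround n hn)
      (Literature.MathematicalPhysics.QuantumFieldTheory.mirrorKernel_symm_of_even heven (hinv n hn))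
      (Literature.MathematicalPhysics.QuantumFieldTheory.mirrorKernel_symm_of_even
        (roundKernel_neg Δ') (roundKernel_reflection Δ' n))
  have key := h K' hc' hpos' hhom' hnine' R x
  simp only [hK', roundKernel, LinearIsometryEquiv.norm_map] at key
  by_cases hx : x = 0
  · subst hx; simp
  · have hr : 0 < ‖x‖ ^ (-(2 * Δ')) := Real.rpow_pos_of_pos (norm_pos_iff.2 hx) _
    exact mul_right_cancel₀ hr.ne' key


/-! ### a = 1 leaf monotonicity (the GLOBAL step at Δ = 1/2) -/

/-- The pointwise identity behind the `a = 1` leaf monotonicity: for `s, t, σ` with `s + σ ≠ 0`,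
`t + σ ≠ 0`, `(1+s)(1-σ)/(s+σ) - (1+t)(1-σ)/(t+σ) = (t-s)(1-σ)²/((s+σ)(t+σ))`. -/
theorem leaf_kernel_identity {s t σ : ℝ} (hs : s + σ ≠ 0) (ht : t + σ ≠ 0) :
    (1 + s) * ((1 - σ) / (s + σ)) - (1 + t) * ((1 - σ) / (t + σ)) =
      (t - s) * ((1 - σ) ^ 2 / ((s + σ) * (t + σ))) := by
  field_simp
  ring

/-- TOOL (a = 1 leaf monotonicity, discrete form). For a finitely supported positive measure
`ρ = Σ w i • δ_{σ i}` on `(0, ∞)` the leaf quantity `Φ(s) = (1+s) Σ w i (1 - σ i)/(s + σ i)`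
— which at `a = 1` equals `(1+s)(C(s) - C(pole))` along a meridian leaf with Stieltjes measure `ρ` —
is non-increasing on `[0, ∞)`: `Φ t ≤ Φ s` for `0 ≤ s ≤ t`, with the explicit nonnegative defect
`Σ w i (t-s)(1-σ i)²/((s+σ i)(t+σ i))`. (Measure version: same proof under the integral sign.) -/
theorem leafPhi_antitone {ι : Type*} (S : Finset ι) (w σ : ι → ℝ) (hw : ∀ i ∈ S, 0 ≤ w i)
    (hσ : ∀ i ∈ S, 0 < σ i) {s t : ℝ} (hs : 0 ≤ s) (hst : s ≤ t) :
    (1 + t) * ∑ i ∈ S, w i * ((1 - σ i) / (t + σ i)) ≤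
      (1 + s) * ∑ i ∈ S, w i * ((1 - σ i) / (s + σ i)) := by
  rw [Finset.mul_sum, Finset.mul_sum, ← sub_nonneg, ← Finset.sum_sub_distrib]
  refine Finset.sum_nonneg fun i hi => ?_
  have h1 : 0 < s + σ i := by linarith [hσ i hi]
  have h2 : 0 < t + σ i := by linarith [hσ i hi]
  have key : (1 + s) * (w i * ((1 - σ i) / (s + σ i))) - (1 + t) * (w i * ((1 - σ i) / (t + σ i))) =
      w i * ((t - s) * ((1 - σ i) ^ 2 / ((s + σ i) * (t + σ i)))) := by
    rw [← leaf_kernel_identity h1.ne' h2.ne']; ring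
  rw [key]
  exact mul_nonneg (hw i hi) (mul_nonneg (by linarith) (div_nonneg (sq_nonneg _) (mul_pos h1 h2).le))

/-- TOOL (a = 1 rigidity of a leaf). In the setting of `leafPhi_antitone`, if `Φ s = Φ t` for some
`0 ≤ s < t` then every atom with positive weight sits at `σ i = 1` (the leaf is round). -/
theorem leaf_round_of_Phi_eq {ι : Type*} (S : Finset ι) (w σ : ι → ℝ) (hw : ∀ i ∈ S, 0 ≤ w i)
    (hσ : ∀ i ∈ S, 0 < σ i) {s t : ℝ} (hs : 0 ≤ s) (hst : s < t)
    (heq : (1 + t) * ∑ i ∈ S, w i * ((1 - σ i) / (t + σ i)) =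
      (1 + s) * ∑ i ∈ S, w i * ((1 - σ i) / (s + σ i))) :
    ∀ i ∈ S, 0 < w i → σ i = 1 := by
  have hterm : ∀ i ∈ S, 0 ≤ w i * ((t - s) * ((1 - σ i) ^ 2 / ((s + σ i) * (t + σ i)))) := by
    intro i hi
    have h1 : 0 < s + σ i := by linarith [hσ i hi]
    have h2 : 0 < t + σ i := by linarith [hσ i hi]
    exact mul_nonneg (hw i hi) (mul_nonneg (by linarith) (div_nonneg (sq_nonneg _) (mul_pos h1 h2).le))
  have hsum : ∑ i ∈ S, w i * ((t - s) * ((1 - σ i) ^ 2 / ((s + σ i) * (t + σ i)))) = 0 := by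
    have : ∑ i ∈ S, ((1 + s) * (w i * ((1 - σ i) / (s + σ i))) -
        (1 + t) * (w i * ((1 - σ i) / (t + σ i)))) = 0 := by
      rw [Finset.sum_sub_distrib, ← Finset.mul_sum, ← Finset.mul_sum, heq, sub_self]
    rw [← this]
    refine Finset.sum_congr rfl fun i hi => ?_
    have h1 : 0 < s + σ i := by linarith [hσ i hi]
    have h2 : 0 < t + σ i := by linarith [hσ i hi]
    rw [← leaf_kernel_identity h1.ne' h2.ne']; ring
  intro i hi hwi
  have hzero := (Finset.sum_eq_zero_iff_of_nonneg hterm).1 hsum i hi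
  have h1 : 0 < s + σ i := by linarith [hσ i hi]
  have h2 : 0 < t + σ i := by linarith [hσ i hi]
  have hts : 0 < t - s := by linarith
  rcases mul_eq_zero.1 hzero with h | h
  · exact absurd h hwi.ne'
  · rcases mul_eq_zero.1 h with h | h
    · exact absurd h hts.ne'
    · rw [div_eq_zero_iff] at h
      rcases h with h | h
      · have : 1 - σ i = 0 := by simpa using h
        linarith
      · exact absurd h (mul_pos h1 h2).ne'

/-! ## (a) Load-bearing analysis: the RP conjunct -/

/-- The crux with the reflection-positivity conjunct DROPPED (the nine mirror invariances kept). -/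
def HRP2RigidityWithoutRP : Prop :=
  ∀ (Δ : ℝ) (K : EuclideanSpace ℝ (Fin 3) → ℝ), 1/2 ≤ Δ → Δ ≤ 1 → ContinuousOn K {0}ᶜ →
    (∀ x, x ≠ 0 → 0 < K x) → (∀ c : ℝ, 0 < c → ∀ x, K (c • x) = c ^ (-(2 * Δ)) * K x) →
    (∀ n : EuclideanSpace ℝ (Fin 3), (∃ i j : Fin 3, i ≠ j ∧ (n = EuclideanSpace.single i 1 ∨
      n = EuclideanSpace.single i 1 + EuclideanSpace.single j 1 ∨
      n = EuclideanSpace.single i 1 - EuclideanSpace.single j 1)) →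
      (∀ x, K (((ℝ ∙ n)ᗮ).reflection x) = K x)) →
    ∀ (R : EuclideanSpace ℝ (Fin 3) ≃ₗᵢ[ℝ] EuclideanSpace ℝ (Fin 3)) (x : EuclideanSpace ℝ (Fin 3)),
      K (R x) = K x

/-- Sanity: the variant is the crux minus one hypothesis (it implies the crux). -/
theorem withoutRP_imp_crux (h : HRP2RigidityWithoutRP) :
    Summit.CriticalPhenomena.Ising3DConformalLimit.Theses.HyperoctahedralRP.HRP2Rigidity :=
  fun Δ K h1 h2 h3 h4 h5 h6 R x => h Δ K h1 h2 h3 h4 h5 (fun n hn => (h6 n hn).1) R x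

/-- **LOAD-BEARING (RP).** The crux without its reflection-positivity conjunct is false: the quartic
kernel `(Σ xᵢ⁴)/(Σ xᵢ²)³` at `Δ = 1` satisfies every other hypothesis and is not `O(3)`-invariant
(`K e₀ = 1`, `K (θ_{(1,1,1)} e₀) = 11/27`). Any proof of `HRP2Rigidity` must use RP. -/
theorem hrp2Rigidity_false_without_RP : ¬ HRP2RigidityWithoutRP := by
  intro h
  have key := h 1 quarticKernel (by norm_num) le_rfl quarticKernel_continuousOn
    (fun x hx => quarticKernel_pos hx) (fun c hc x => quarticKernel_smul hc x)
    (fun n hn x => quarticKernel_reflection n hn x) ((ℝ ∙ v111)ᗮ.reflection)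
    (EuclideanSpace.single (0 : Fin 3) (1 : ℝ))
  rw [quarticKernel_reflection_v111_e0, quarticKernel_e0] at key
  norm_num at key

/-- Within the window: the crux at `Δ = 1` implies the crux at `Δ = 1/2`, GIVEN nine-mirror RP of
`‖x‖⁻¹` (Frank–Lieb / Glimm–Jaffe; hypothesis). Equivalently a counterexample at `Δ = 1/2` produces one
at `Δ = 1` — hunt at `Δ = 1`. -/
theorem hrp2RigidityAt_half_of_one
    (hround : ∀ n : E3, NineNormal n → RPForm n (roundKernel (1 / 2)))
    (h : HRP2RigidityAt 1) : HRP2RigidityAt (1 / 2) := by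
  refine hrp2RigidityAt_of_add (Δ' := 1 / 2) hround ?_
  norm_num
  exact h

end Summit.CriticalPhenomena.Ising3DConformalLimit.Cruxes.HRP2Rigidity.Disproof
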